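import Summits.QuantumFields.GaugeBoot.AdInvariantSchwingerDysonRows
import Summits.QuantumFields.GaugeBoot.PolynomialSchwingerDyson
import Summits.QuantumFields.GaugeBoot.DiagonalRPTorusUnitaryMoments
import Literature.MathematicalPhysics.QuantumFieldTheory.LatticeGaugeAsymptoticsFreeEnergyProofs
import Literature.MathematicalPhysics.QuantumFieldTheory.Balaban1983to89.InfiniteVolumeSufficientXIX
import HarnessLib

/-!
# Conjugation-invariant Schwinger–Dyson rows of the torus Wilson theory are trivial: `SU(N)` and `U(N)` (gauge-boot, L1 supplement)

HONEST FRAMING (cell `pub-gaugeboot`, page 1 of every file): the venture produces certified bounds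
on lattice expectations at stated coupling, gauge group, dimension and torus size; NOT a mass gap,
NOT a continuum limit, NOT a string tension; NOT Yang–Mills-summit-bearing (barriers
`FixedCouplingUltralocality`, `PerturbativeInvisibility`). Structural (a no-information statement
about a class of bootstrap rows); it certifies no number.

## Content

`AdInvariantSchwingerDysonRows.lean` shows on any configuration space `ι → G`: for a state `μ`
invariant under global conjugation `U ↦ (g U_i g⁻¹)_i`, a conjugation-invariant polynomial test
function `f`, a conjugation-invariant polynomial action `S` and a TRACELESS generator `X`, both sides
of the one-link Schwinger–Dyson row `∫ X·f dμ = β ∫ f · (X·S) dμ` vanish (Schur averaging), so the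
row holds at every `β`. Here this is instantiated for the Wilson action on the torus `(ℤ/L)^d`:

* `gaugeTransform_const` — global conjugation is the gauge transformation by a constant gauge
  function; `wilsonAction_conjAct`, `map_conjAct_wilsonMeasure` — the Wilson action and Wilson's
  measure are conjugation invariant (tree `wilsonAction_gaugeTransform`,
  `wilsonMeasure_map_gaugeTransform_holds`); `exists_hasLinearShiftDeriv_wilsonAction` — the Wilson
  action has a linear one-link shift derivative (it is a polynomial observable);
* `hasSchurMoments_suN`, `hasSchurMoments_uN` — the Schur second moments of the defining
  representations (tree `integral_entry_mul_conj_entry`, `integral_entry_mul_conj_entry_unitary`);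
* ★★ `sdRow_wilson_of_conjInvariant` — any compact `G` through a faithful unitary `r : LatticeRep G`
  with the Schur moments: every conjugation-invariant finite measure on `GaugeConfig d L G`
  satisfies, at EVERY `β`, every Schwinger–Dyson row of the Wilson action whose test function is a
  conjugation-invariant polynomial observable and whose generator is traceless;
* ★★★ `sdRow_wilson_of_conjInvariant_suN` / `_uN` — `G = SU(N)` along `e^{tX}`, `X ∈ 𝔰𝔲(N)`, and
  `G = U(N)` along `e^{tX}`, `X ∈ 𝔲(N)` traceless;
* ★★★ `sdRow_wilsonMeasure_all_couplings_suN` / `_uN` — in particular WILSON'S MEASURE AT ANY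
  COUPLING `β'` SATISFIES ALL THESE ROWS OF THE THEORY AT COUPLING `β`: the conjugation-invariant
  (a fortiori gauge-invariant) rows of the loop equations do not see the coupling, let alone the
  state. The information of the bootstrap's loop equations (`PolynomialSchwingerDyson.lean`: ALL
  polynomial rows determine Wilson's measure) is carried entirely by test functions that are NOT
  conjugation invariant — the matrix-valued open strings `(hol_w)_{ij}` of the cell's `sd_pair`
  (Makeenko–Migdal) — and, for `U(N)`, by the single `U(1)` generator `X = i·1`.

* `ℤ^d`: `sdRow_zd_of_conjInvariant` (local actions `wilsonBoundaryAction ρ Λ`, any conjugation-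
  invariant finite `μ`) and ★★★ `sdRow_of_mem_infiniteVolumeLimitPoints_suN` — every infinite-volume
  limit point of the `SU(N)` torus states at any `β'` (gauge invariant by the tree's
  `map_gaugeTransformZd_of_mem_infiniteVolumeLimitPoints`) satisfies all these rows at every `β`.

References: Yu. Makeenko, A. Migdal, Phys. Lett. B 88 (1979) 135; M. Creutz, *Quarks, gluons and
lattices* (1983) Ch. 8, 11; V. Kazakov, Z. Zheng, arXiv:2203.11360 §2; P. Anderson, M. Kruczenski,
Nucl. Phys. B 921 (2017) 702. Folklore (Schur averaging); not located in print as stated.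
-/

noncomputable section

open MeasureTheory Filter Topology NormedSpace
open scoped Matrix
open Literature.MathematicalPhysics.QuantumFieldTheory hiding ZdEdge Site
open Literature.MathematicalPhysics.QuantumLattice
open Summit.Ventures.YMGap.RobustBall.HaarSecondMoments (integral_entry_mul_conj_entry)

namespace Summit.QuantumFields.GaugeBoot

/-! ## Torus glue: conjugation invariance of the Wilson action and measure -/

section Torus

variable {d L : ℕ} {G : Type*} [Group G] [TopologicalSpace G] (r : LatticeRep G)

omit [TopologicalSpace G] in
/-- Global conjugation is the gauge transformation by the constant gauge function. -/
theorem gaugeTransform_const (g : G) :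
    gaugeTransform (d := d) (L := L) (fun _ => g) = conjAct (ι := Edge d L) g := rfl

omit [TopologicalSpace G] in
/-- The Wilson action is invariant under global conjugation (tree `wilsonAction_gaugeTransform`).
[folklore] -/
theorem wilsonAction_conjAct [NeZero L] {N : ℕ} (ρ : G →* Matrix (Fin N) (Fin N) ℂ) (g : G)
    (U : GaugeConfig d L G) : wilsonAction ρ (conjAct g U) = wilsonAction ρ U := by
  rw [← gaugeTransform_const]
  exact wilsonAction_gaugeTransform ρ (fun _ => g) U

/-- Wilson's measure is invariant under global conjugation (tree
`wilsonMeasure_map_gaugeTransform_holds`, Wilson 1974 §III.B). [folklore] -/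
theorem map_conjAct_wilsonMeasure [NeZero L] [IsTopologicalGroup G] [CompactSpace G]
    [MeasurableSpace G] [BorelSpace G] {N : ℕ} (ρ : G →* Matrix (Fin N) (Fin N) ℂ) (β : ℝ) (g : G) :
    (wilsonMeasure (d := d) (L := L) ρ β).map (conjAct g) = wilsonMeasure ρ β := by
  rw [← gaugeTransform_const]
  exact wilsonMeasure_map_gaugeTransform_holds ρ β (fun _ => g)

/-- The torus Wilson action of a faithful unitary representation has a linear one-link shift
derivative at every link (it is a polynomial observable, `wilsonAction_mem_polyFunctions`).
[folklore] -/
theorem exists_hasLinearShiftDeriv_wilsonAction [NeZero L] [ContinuousMul G] (e : Edge d L) :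
    ∃ D : GaugeConfig d L G → Matrix (Fin r.N) (Fin r.N) ℂ →ₗ[ℝ] ℝ,
      HasLinearShiftDeriv r e (wilsonAction (d := d) (L := L) r.ρ) D :=
  exists_hasLinearShiftDeriv_of_mem_polyFunctions r e (wilsonAction_mem_polyFunctions r)

/-- ★★ **Conjugation-invariant rows of the torus Wilson theory are trivial** (any compact `G`
through a faithful unitary `r` with the Schur second moments): for every finite measure `μ` on
`GaugeConfig d L G` invariant under global conjugation, every link `e`, every conjugation-invariant
polynomial observable `f`, every traceless generator `X` (`ρ(k t) = e^{tX}`) and EVERY real `β`,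
the Schwinger–Dyson row `∫ X·f dμ = β ∫ f · (X·S_W) dμ` of the Wilson action holds (both sides
vanish). [folklore] -/
theorem sdRow_wilson_of_conjInvariant [NeZero L] [IsTopologicalGroup G] [CompactSpace G]
    [MeasurableSpace G] [BorelSpace G] [SecondCountableTopology G] (hr : HasSchurMoments r)
    {μ : Measure (GaugeConfig d L G)} [IsFiniteMeasure μ]
    (hμ : ∀ g : G, μ.map (conjAct g) = μ) (e : Edge d L) {f : GaugeConfig d L G → ℝ}
    (hf : f ∈ polyFunctions (ι := Edge d L) r) (hfi : ∀ g U, f (conjAct g U) = f U)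
    {k : ℝ → G} {X : Matrix (Fin r.N) (Fin r.N) ℂ} (hX : ∀ t, r.ρ (k t) = exp ((t : ℂ) • X))
    (htr : X.trace = 0) {f' S' : GaugeConfig d L G → ℝ}
    (hf' : ∀ U, HasDerivAt (fun t => f (Function.update U e (k t * U e))) (f' U) 0)
    (hS' : ∀ U, HasDerivAt (fun t => wilsonAction r.ρ (Function.update U e (k t * U e))) (S' U) 0)
    (β : ℝ) : ∫ U, f' U ∂μ = β * ∫ U, f U * S' U ∂μ := by
  obtain ⟨Df, hDf⟩ := exists_hasLinearShiftDeriv_of_mem_polyFunctions r e hf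
  obtain ⟨DS, hDS⟩ := exists_hasLinearShiftDeriv_wilsonAction (d := d) (L := L) r e
  exact sdRow_of_conjInvariant hr hμ hDf hDS (continuous_of_mem_polyFunctions r hf) hfi
    (fun g U => wilsonAction_conjAct r.ρ g U) hX htr hf' hS' β

end Torus

/-! ## `SU(N)` and `U(N)` -/

section Unitary

variable {d L : ℕ} [NeZero L]

/-- The defining representation of `SU(N)` has the Schur second moments (tree
`integral_entry_mul_conj_entry`). [folklore] -/
theorem hasSchurMoments_suN (N : ℕ) : HasSchurMoments (fundamentalLatticeRep N) := fun a i b k =>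
  integral_entry_mul_conj_entry (fundamentalRep (Fin N))
    (TorusAreaLaw.isSpecialUnitaryModel_fundamentalRep N) a i b k

/-- The defining representation of `U(N)` has the Schur second moments (tree
`DiagRPSUN.integral_entry_mul_conj_entry_unitary`). [folklore] -/
theorem hasSchurMoments_uN (N : ℕ) : HasSchurMoments (unitaryFundamentalLatticeRep N) := fun a i b k =>
  DiagRPSUN.integral_entry_mul_conj_entry_unitary (unitaryFundamentalRep (Fin N) ℂ)
    (isUnitaryModel_unitaryFundamentalRep N) a i b k

/-- ★★★ **`SU(N)` on the torus `(ℤ/L)^d`**: every finite measure invariant under global conjugation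
satisfies, at EVERY real `β`, every Schwinger–Dyson row of the Wilson action along `e^{tX}`,
`X ∈ 𝔰𝔲(N)`, whose test function is a conjugation-invariant polynomial observable — both sides are
`0`. [folklore] -/
theorem sdRow_wilson_of_conjInvariant_suN (N : ℕ)
    {μ : Measure (GaugeConfig d L (Matrix.specialUnitaryGroup (Fin N) ℂ))} [IsFiniteMeasure μ]
    (hμ : ∀ g, μ.map (conjAct g) = μ) (e : Edge d L)
    {f : GaugeConfig d L (Matrix.specialUnitaryGroup (Fin N) ℂ) → ℝ}
    (hf : f ∈ polyFunctions (ι := Edge d L) (fundamentalLatticeRep N))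
    (hfi : ∀ g U, f (conjAct g U) = f U) (X : SuGenerator N)
    {f' S' : GaugeConfig d L (Matrix.specialUnitaryGroup (Fin N) ℂ) → ℝ}
    (hf' : ∀ U, HasDerivAt (fun t => f (Function.update U e (suExp N X t * U e))) (f' U) 0)
    (hS' : ∀ U, HasDerivAt (fun t => wilsonAction (fundamentalRep (Fin N))
      (Function.update U e (suExp N X t * U e))) (S' U) 0) (β : ℝ) :
    ∫ U, f' U ∂μ = β * ∫ U, f U * S' U ∂μ :=
  sdRow_wilson_of_conjInvariant (fundamentalLatticeRep N) (hasSchurMoments_suN N) hμ e hf hfi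
    (rho_suExp N X) X.2.2 hf' hS' β

/-- ★★★ **`U(N)` on the torus**: the same along `e^{tX}` for every TRACELESS `X ∈ 𝔲(N)`. (For
`X = i·1`, the `U(1)` direction, the row is genuinely informative.) [folklore] -/
theorem sdRow_wilson_of_conjInvariant_uN (N : ℕ)
    {μ : Measure (GaugeConfig d L (Matrix.unitaryGroup (Fin N) ℂ))} [IsFiniteMeasure μ]
    (hμ : ∀ g, μ.map (conjAct g) = μ) (e : Edge d L)
    {f : GaugeConfig d L (Matrix.unitaryGroup (Fin N) ℂ) → ℝ}
    (hf : f ∈ polyFunctions (ι := Edge d L) (unitaryFundamentalLatticeRep N))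
    (hfi : ∀ g U, f (conjAct g U) = f U) (X : UGenerator N)
    (htr : (X : Matrix (Fin N) (Fin N) ℂ).trace = 0)
    {f' S' : GaugeConfig d L (Matrix.unitaryGroup (Fin N) ℂ) → ℝ}
    (hf' : ∀ U, HasDerivAt (fun t => f (Function.update U e (uExp N X t * U e))) (f' U) 0)
    (hS' : ∀ U, HasDerivAt (fun t => wilsonAction (unitaryFundamentalRep (Fin N) ℂ)
      (Function.update U e (uExp N X t * U e))) (S' U) 0) (β : ℝ) :
    ∫ U, f' U ∂μ = β * ∫ U, f U * S' U ∂μ :=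
  sdRow_wilson_of_conjInvariant (unitaryFundamentalLatticeRep N) (hasSchurMoments_uN N) hμ e hf hfi
    (rho_uExp N X) htr hf' hS' β

/-- ★★★ **The conjugation-invariant rows do not see the coupling (`SU(N)`)**: Wilson's measure at
ANY coupling `β'` satisfies every Schwinger–Dyson row of the `SU(N)` Wilson theory at coupling `β`
whose test function is a conjugation-invariant (e.g. gauge-invariant) polynomial observable, for
all real `β`, `β'`. [folklore] -/
theorem sdRow_wilsonMeasure_all_couplings_suN (N : ℕ) (β β' : ℝ) (e : Edge d L)
    {f : GaugeConfig d L (Matrix.specialUnitaryGroup (Fin N) ℂ) → ℝ}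
    (hf : f ∈ polyFunctions (ι := Edge d L) (fundamentalLatticeRep N))
    (hfi : ∀ g U, f (conjAct g U) = f U) (X : SuGenerator N)
    {f' S' : GaugeConfig d L (Matrix.specialUnitaryGroup (Fin N) ℂ) → ℝ}
    (hf' : ∀ U, HasDerivAt (fun t => f (Function.update U e (suExp N X t * U e))) (f' U) 0)
    (hS' : ∀ U, HasDerivAt (fun t => wilsonAction (fundamentalRep (Fin N))
      (Function.update U e (suExp N X t * U e))) (S' U) 0) :
    ∫ U, f' U ∂(wilsonMeasure (fundamentalRep (Fin N)) β') =
      β * ∫ U, f U * S' U ∂(wilsonMeasure (fundamentalRep (Fin N)) β') := by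
  haveI := isProbabilityMeasure_wilsonMeasure (d := d) (L := L) (fundamentalRep (Fin N))
    (continuous_fundamentalRep (Fin N)) β'
  exact sdRow_wilson_of_conjInvariant_suN N
    (fun g => map_conjAct_wilsonMeasure (fundamentalRep (Fin N)) β' g) e hf hfi X hf' hS' β

/-- ★★★ **The conjugation-invariant rows do not see the coupling (`U(N)`, traceless generators).**
[folklore] -/
theorem sdRow_wilsonMeasure_all_couplings_uN (N : ℕ) (β β' : ℝ) (e : Edge d L)
    {f : GaugeConfig d L (Matrix.unitaryGroup (Fin N) ℂ) → ℝ}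
    (hf : f ∈ polyFunctions (ι := Edge d L) (unitaryFundamentalLatticeRep N))
    (hfi : ∀ g U, f (conjAct g U) = f U) (X : UGenerator N)
    (htr : (X : Matrix (Fin N) (Fin N) ℂ).trace = 0)
    {f' S' : GaugeConfig d L (Matrix.unitaryGroup (Fin N) ℂ) → ℝ}
    (hf' : ∀ U, HasDerivAt (fun t => f (Function.update U e (uExp N X t * U e))) (f' U) 0)
    (hS' : ∀ U, HasDerivAt (fun t => wilsonAction (unitaryFundamentalRep (Fin N) ℂ)
      (Function.update U e (uExp N X t * U e))) (S' U) 0) :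
    ∫ U, f' U ∂(wilsonMeasure (unitaryFundamentalRep (Fin N) ℂ) β') =
      β * ∫ U, f U * S' U ∂(wilsonMeasure (unitaryFundamentalRep (Fin N) ℂ) β') := by
  haveI := isProbabilityMeasure_wilsonMeasure (d := d) (L := L) (unitaryFundamentalRep (Fin N) ℂ)
    (continuous_unitaryFundamentalRep (Fin N) ℂ) β'
  exact sdRow_wilson_of_conjInvariant_uN N
    (fun g => map_conjAct_wilsonMeasure (unitaryFundamentalRep (Fin N) ℂ) β' g) e hf hfi X htr
    hf' hS' β

end Unitary

/-! ## The infinite lattice `ℤ^d` -/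

section Zd

variable {d : ℕ} {G : Type*} [Group G] [TopologicalSpace G] (r : LatticeRep G)

omit [TopologicalSpace G] in
/-- On `ℤ^d`, global conjugation is the gauge transformation by the constant gauge function. -/
theorem gaugeTransformZd_const (g : G) :
    gaugeTransformZd (d := d) (fun _ => g) = conjAct (ι := ZdEdge d) g := rfl

omit [TopologicalSpace G] in
/-- The boundary Wilson actions `S_Λ` of `ℤ^d` are invariant under global conjugation (tree
`wilsonBoundaryAction_gaugeTransformZd`). [folklore] -/
theorem wilsonBoundaryAction_conjAct {N : ℕ} (ρ : G →* Matrix (Fin N) (Fin N) ℂ)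
    (Λ : Finset (ZdEdge d)) (g : G) (U : LGConfig d G) :
    wilsonBoundaryAction ρ Λ (conjAct g U) = wilsonBoundaryAction ρ Λ U := by
  rw [← gaugeTransformZd_const]
  exact wilsonBoundaryAction_gaugeTransformZd ρ Λ (fun _ => g) U

/-- ★★ **`ℤ^d`: conjugation-invariant rows of the local Wilson actions are trivial.** For every finite
measure `μ` on `LGConfig d G` invariant under global conjugation, every finite link set `Λ` (the
lane's local action is `S_e = wilsonBoundaryAction ρ {e}`), every link `e`, every conjugation-invariant
polynomial observable `f`, every traceless generator and EVERY real `β`: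
`∫ X·f dμ = β ∫ f · (X·S_Λ) dμ` (both sides vanish). [folklore] -/
theorem sdRow_zd_of_conjInvariant [IsTopologicalGroup G] [CompactSpace G] [MeasurableSpace G]
    [BorelSpace G] [SecondCountableTopology G] (hr : HasSchurMoments r)
    {μ : Measure (LGConfig d G)} [IsFiniteMeasure μ] (hμ : ∀ g : G, μ.map (conjAct g) = μ)
    (Λ : Finset (ZdEdge d)) (e : ZdEdge d) {f : LGConfig d G → ℝ}
    (hf : f ∈ polyFunctions (ι := ZdEdge d) r) (hfi : ∀ g U, f (conjAct g U) = f U)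
    {k : ℝ → G} {X : Matrix (Fin r.N) (Fin r.N) ℂ} (hX : ∀ t, r.ρ (k t) = exp ((t : ℂ) • X))
    (htr : X.trace = 0) {f' S' : LGConfig d G → ℝ}
    (hf' : ∀ U, HasDerivAt (fun t => f (Function.update U e (k t * U e))) (f' U) 0)
    (hS' : ∀ U, HasDerivAt (fun t => wilsonBoundaryAction r.ρ Λ (Function.update U e (k t * U e)))
      (S' U) 0) (β : ℝ) :
    ∫ U, f' U ∂μ = β * ∫ U, f U * S' U ∂μ := by
  obtain ⟨Df, hDf⟩ := exists_hasLinearShiftDeriv_of_mem_polyFunctions r e hf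
  obtain ⟨DS, hDS⟩ := exists_hasLinearShiftDeriv_of_mem_polyFunctions r e
    (wilsonBoundaryAction_mem_polyFunctions r Λ)
  exact sdRow_of_conjInvariant hr hμ hDf hDS (continuous_of_mem_polyFunctions r hf) hfi
    (fun g U => wilsonBoundaryAction_conjAct r.ρ Λ g U) hX htr hf' hS' β

/-- ★★★ **`SU(N)` on `ℤ^d`: every infinite-volume limit point of the torus Wilson states at ANY
coupling `β'` satisfies, at EVERY `β`, every one-link Schwinger–Dyson row of the local Wilson action
`S_e` along `e^{tX}`, `X ∈ 𝔰𝔲(N)`, whose test function is a conjugation-invariant polynomial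
observable** (limit points are gauge invariant, tree
`map_gaugeTransformZd_of_mem_infiniteVolumeLimitPoints`). [folklore] -/
theorem sdRow_of_mem_infiniteVolumeLimitPoints_suN (N : ℕ) {β' : ℝ}
    {μ : Measure (LGConfig d (Matrix.specialUnitaryGroup (Fin N) ℂ))}
    (hμ : μ ∈ infiniteVolumeLimitPoints (d := d) (fundamentalRep (Fin N)) β') (e : ZdEdge d)
    {f : LGConfig d (Matrix.specialUnitaryGroup (Fin N) ℂ) → ℝ}
    (hf : f ∈ polyFunctions (ι := ZdEdge d) (fundamentalLatticeRep N))
    (hfi : ∀ g U, f (conjAct g U) = f U) (X : SuGenerator N)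
    {f' S' : LGConfig d (Matrix.specialUnitaryGroup (Fin N) ℂ) → ℝ}
    (hf' : ∀ U, HasDerivAt (fun t => f (Function.update U e (suExp N X t * U e))) (f' U) 0)
    (hS' : ∀ U, HasDerivAt (fun t => wilsonBoundaryAction (fundamentalRep (Fin N)) {e}
      (Function.update U e (suExp N X t * U e))) (S' U) 0) (β : ℝ) :
    ∫ U, f' U ∂μ = β * ∫ U, f U * S' U ∂μ := by
  haveI : IsProbabilityMeasure μ := by
    obtain ⟨L, -, hL⟩ := hμ
    exact hL.1
  have hμc : ∀ g : Matrix.specialUnitaryGroup (Fin N) ℂ, μ.map (conjAct g) = μ := fun g => by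
    rw [← gaugeTransformZd_const]
    exact map_gaugeTransformZd_of_mem_infiniteVolumeLimitPoints (fundamentalRep (Fin N))
      (continuous_fundamentalRep (Fin N)) hμ (fun _ => g)
  exact sdRow_zd_of_conjInvariant (fundamentalLatticeRep N) (hasSchurMoments_suN N) hμc {e} e hf hfi
    (rho_suExp N X) X.2.2 hf' hS' β

end Zd

end Summit.QuantumFields.GaugeBoot

end
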